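import Mathlib
import HarnessLib
import Summits.QuantumFields.Statement
import Literature.MathematicalPhysics.QuantumLattice.LatticeGaugeDLR

/-!
Route: XiCompleteMonotonicity

# Route XiCompleteMonotonicity — xi_lat(beta) >= exp(c beta)/(K beta): RP log-convexity of the
plaquette two-point function plus ONE perturbative-window lower bound

SUPPORT-STATEMENT route (lattice leg, infrared-from-below), realising card
xi-lower-bound-complete-monotonicity. It suffices to show
X = XiExpLowerBound: for every compact simple Lie group G and faithful unitary lattice
representation r there are β₀, c > 0, K such
that for all β ≥ β₀ and EVERY infinite-volume limit point μ of 4-d Wilson lattice gauge theory at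
inverse coupling β (tree
`infiniteVolumeLimitPoints r.ρ β`, Chatterjee's setting), the axial plaquette–plaquette correlation
a(n) = f_β(n e₀)
(`plaquetteCorrFn`) obeys a(n) ≥ A e^(−m n) for all n with A > 0 and 0 ≤ m ≤ K β e^(−cβ): the
inverse lattice correlation length is
exponentially small, ξ_lat(β) ≥ e^(cβ)/(Kβ) — an asymptotic-scaling-SHAPED lower bound, in
particular ξ_lat(β) → ∞ uniformly over
limit points (the second half of Chatterjee's Problem 5.1, tree `LatticeMassGapAllCouplings`,
registered OPEN). X splits as
X ⇐ AxialLogConvexity (reflection positivity, provable now) ∧ ExponentialWindow (leading-order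
lattice perturbation theory for ONE
correlator certified out to separations e^(cβ)); weaker windows (PolynomialWindow;
FixedDistanceLower + PlaquetteVarianceUpper) give
the qualitative XiDiverges. Toward `YangMills` X is the "critical point at β = ∞" half of the
lattice leg: it makes the natural
scale-setting a_k := m(β_k)/Δ tend to 0 (needed by `SpeciesScheme`, forced by
Literature.Barriers.QuantumFields.FixedCouplingUltralocality)
and, through the support item AsymptoticFreedomBound, forces every Wilson-lattice witness with
`HasLatticeMassGap … Δ` and β_k → ∞ to
shrink its spacing at least like Δ a_k ≤ K β_k e^(−cβ_k).
Lean: `∀ (G : Type) [Group G] [TopologicalSpace G] [IsTopologicalGroup G] [CompactSpace G]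
[MeasurableSpace G] [BorelSpace G],
Literature.MathematicalPhysics.QuantumFieldTheory.IsCompactSimpleLieGroup G → ∀ r :
Literature.MathematicalPhysics.QuantumFieldTheory.LatticeRep G, ∃ β₀ c K : ℝ, 0 < c ∧ ∀ β : ℝ, β₀ ≤
β → ∀ μ ∈ Literature.MathematicalPhysics.QuantumLattice.infiniteVolumeLimitPoints (d := 4) r.ρ β, ∃
m A : ℝ, 0 < A ∧ 0 ≤ m ∧ m ≤ K * β * Real.exp (-(c * β)) ∧ ∀ n : ℕ, A * Real.exp (-(m * n)) ≤
Literature.MathematicalPhysics.QuantumLattice.plaquetteCorrFn r.ρ μ ((n : ℤ) • Pi.single (0 : Fin 4)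
(1 : ℤ))`

## Assembly
Real analysis only (no measure theory; the tree's `StringTension.neg_log_add_le_of_sq_le_mul` /
`StringTension.tendsto_div_of_concave_nonneg` in
Literature.MathematicalPhysics.QuantumFieldTheory.StringTensionAnalysis already turn log-convexity
into rate bounds for Wilson loops): fix G, r; take β₀' ≥ max(β₀, 1, log(n₀+4)/c), t := ⌊e^(cβ)⌋₊ (so
n₀ ≤ t ≤ e^(cβ), t−1 ≥ e^(cβ)/2).
ExponentialWindow gives a(t) ≥ A/(β²t⁸) > 0; AxialLogConvexity (β ≥ 0) gives a ≥ 0, a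
non-increasing, a ≤ N² and log-convexity on n ≥ 1,
hence a(n) > 0 for n ≥ 1 and the chord inequality a(n) ≥ a(t) e^(−m n) for all n with m := (log a(1)
− log a(t))/(t−1) ∈ [0, K β e^(−cβ)],
K := 2(2|log N| + |log A| + 2 + 8c); A' := a(t). Hence XiExpLowerBound.

Rationale: WHY THIS LINE. Reflection positivity in lattice AND half-lattice time hyperplanes
(OsterwalderSeiler1978 §2, Seiler1982 Ch. 2, doi:10.1007/bf01614090,
FrohlichIsraelLiebSimon1978 Thm 2.1; tree TorusSiteRP / TorusLoopLinkRP / TorusOddRP already run the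
Cauchy–Schwarz for Wilson loops on even
and odd tori and pass to limit states) makes n ↦ a(n) non-negative, non-increasing and log-convex
from n = 1 — the finite shadow of complete
monotonicity a(n) = ∫ λ^(n−1) dν — so ONE lower bound a(t) ≥ A/(β² t⁸) at ONE separation t bounds
the decay rate for all n:
m ≤ (t−1)⁻¹ log(a(1)/a(t)). The infrared (confinement, uniqueness of the state, clustering) is never
touched; all the work is a
weak-coupling statement about one gauge-invariant correlator at separations where the running
coupling is still small (two-gluon
exchange, a(n) ≈ c_G/(β² n⁸) > 0), i.e. the observable version of Bałaban's small-field analysis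
(Balaban1987RG1, Balaban1988Convergent,
Balaban1989LargeFieldII) that Jaffe–Witten §6.5 name as the missing step, with Chatterjee2016 /
doi:10.1007/s10955-026-03649-4 (leading
free-energy term, infinite volume) and Chatterjee2026YMHiggs as the existing rigorous weak-coupling
technology. Imported areas: spectral
theory of positive contractions (moment sequences / log-convexity) and constructive multiscale
analysis; no probabilistic reformulation
beyond Chatterjee's. Nothing in the tree or the negatives index attacks ξ_lat from BELOW; every
other YangMills card bounds ξ from above.

RANKED CRUXES. #0 XiExpLowerBound (target) — X as in § Thesis: for every compact simple Lie G and
faithful unitary r, ∃ β₀ c K, c > 0, ∀ β ≥ β₀, ∀ μ ∈ infiniteVolumeLimitPoints r.ρ β, ∃ m A, A > 0,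
0 ≤ m ≤ K β e^(−cβ), ∀ n, A e^(−mn) ≤ f_β(n e₀) (card item X, quantified over limit points as in
Chatterjee Problem 5.1). (why it might fail: Only through ExponentialWindow: certified lattice PT
out to e^(cβ) separations uniformly over ALL torus limit points is an unbuilt
Balaban-with-observables theorem; the RP half cannot fail for β ≥ 0.) [ChatterjeeYMProb2019,
Chatterjee2016, Balaban1989LargeFieldII, Seiler1982]
#2 ExponentialWindow (crux) — exponential perturbative window (card K2): ∃ β₀, c > 0, A > 0, n₀ such
that for all β ≥ β₀, every limit point μ at β and all n₀ ≤ n ≤ e^(cβ): f_β(n e₀) ≥ A/(β² n⁸) —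
leading-order (two-gluon) lattice perturbation theory for the axial plaquette two-point function is
accurate to a factor out to exponentially large separations, where the running coupling is still
small. [difficulty: open-problem] (why it might fail: Needs PT with running coupling certified over
~cβ RG scales, uniformly in the volume and over limit points (Balaban with observables, never
built); Balaban's large-field remainders are absolute while a ~ β⁻²n⁻⁸ is tiny, so relative accuracy
may exceed the method.) [Balaban1987RG1, Balaban1988Convergent, Balaban1989LargeFieldII,
JaffeWitten2000, Chatterjee2016, Dimock2022QED3]
#3 PolynomialWindow (crux) — polynomial perturbative window (the card's "file first" rung): ∃ β₀, p
> 0, A > 0, n₀ with f_β(n e₀) ≥ A/(β² n⁸) for all β ≥ β₀, all limit points μ and all n₀ ≤ n ≤ β^p.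
Only O(log β) scales, over which the coupling does not run appreciably (no coupling-constant
renormalisation); with AxialLogConvexity it already gives ξ_lat ≥ β^p/((8p+2) log β + C) → ∞ (glue
XiDivergesOfPolynomial). [difficulty: XL] (why it might fail: Still a multi-scale expansion in
infinite volume at fixed large β where the IR is non-perturbative: no cluster expansion converges
uniformly in the volume there, and the random boundary data outside the perturbative box must be
shown to affect a(n) only at relative order <1.) [Balaban1987RG1, Balaban1988Convergent,
Chatterjee2016, doi:10.1007/s10955-026-03649-4, arXiv:2202.10375]
#4 FixedDistanceLower (crux) — fixed-distance leading-order lower asymptotics, pointwise in the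
separation: ∃ A > 0, n₀ such that for every n ≥ n₀ there is β_n with f_β(n e₀) ≥ A/(β² n⁸) for all β
≥ β_n and all limit points μ at β — local weak-coupling Gaussianity of 4-d non-abelian lattice gauge
theory at the level of one covariance, uniformly over infinite-volume limit points (finitely many
scales; chessboard/RP large-field bounds + Markov property + integration by parts are the
non-Balaban tools). With PlaquetteVarianceUpper and AxialLogConvexity it gives XiDiverges (glue
XiDivergesOfFixedDistance). [difficulty: L] (why it might fail: Even E(N−O_p) ≍ 1/β in infinite
volume is known only via free-energy convexity (Chatterjee2016); a covariance at distance n needs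
genuinely local control of large fields and of the non-perturbative boundary, uniformly over limit
points (odd tori: no chessboard).) [Chatterjee2016, doi:10.1007/s10955-026-03649-4,
FrohlichLieb1978, FrohlichIsraelLiebSimon1978, Chatterjee2026YMHiggs]
#5 PlaquetteVarianceUpper (crux) — sharp second moment: ∃ B, β₁ with Var_μ(Re tr r.ρ(U_p)) = f_β(0)
≤ B/β² for all β ≥ β₁ and all limit points μ at β (one-loop: Var ≈ dim G · O(g⁴)); the normaliser
that turns FixedDistanceLower into ξ_lat → ∞, and the first genuinely local weak-coupling estimate
in infinite volume. [difficulty: M] (why it might fail: Convexity of the free energy yields only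
E(N−O_p)=O(1/β), hence Var=O(1/β), one log β short in the glue; the sharp O(1/β²) needs a
fourth-moment / large-field bound uniform over ALL torus limit points (odd tori lack chessboard
estimates).) [Chatterjee2016, doi:10.1007/s10955-026-03649-4, FrohlichLieb1978, MontvayMunster1994]
#6 XiRemainderToClay (crux) — the remainder of the Clay problem GIVEN X, shared with every
lattice-first line (gap leg + UV/OS legs): for every compact simple Lie G and faithful unitary r,
X's conclusion for (G, r) → ∃ a sequential scheme sch and OS data T with IsYangMillsFor r sch T,
non-trivial and non-Gaussian tr F², and Δ > 0 with T.HasMassGap Δ ∧ HasLatticeMassGap r sch Δ. X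
enters exactly once: the scale-setting a_k := m(β_k)/Δ_phys has a_k → 0 (and a_k ≤ K β_k
e^(−cβ_k)/Δ) because m(β_k) ≤ K β_k e^(−cβ_k); everything else (volume-uniform lattice gap at the
matched rate, joint continuum limit of all gauge-invariant Schwinger functions, E0–E4,
non-Gaussianity) is owned by the gap/UV cards (ricci-heat-kernel-polchinski-lsi-gap,
parabolic-renormalised-trajectory, finite-size-criterion-crossover, os-legs-fine-print) and sibling
routes' `…ToClay` items. Filed so that the deciding theorem `closes : XiExpLowerBound →
XiRemainderToClay → YangMills` (pure logic, planner's Closes.lean) exists (D-0027 §2.1). [deps: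
XiExpLowerBound] [difficulty: open-problem] (why it might fail: It is the rest of the Millennium
problem: X gives only a_k → 0 and a one-sided rate; the gap leg (upper bound on ξ_lat at a matched
rate, all observables, uniform in volume) and the UV/OS legs (convergence, not just UV stability)
are open.) [JaffeWitten2000, Balaban1988Convergent, MagnenRivasseauSeneor1993,
OsterwalderSeiler1978, GlimmJaffe1987]
#9 AxialLogConvexity (support) — the RP half (provable now): for β ≥ 0 and every limit point μ, a(n)
= f_β(n e₀) satisfies 0 ≤ a(n), a(n+1) ≤ a(n), a(n) ≤ N², and a(n+2)² ≤ a(n+1)·a(n+3) for all n —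
non-negativity and log-convexity from the Cauchy–Schwarz inequality of the site-plane (odd
separations) and half-plane (even separations ≥ 2) reflection-positive forms applied to centred
plaquettes, exactly as tree TorusSiteRP/TorusLoopLinkRP/TorusOddRP do for Wilson loops, then passage
to limit points as in StringTension.hasStringTension_of_eventually; monotonicity from boundedness +
log-convexity and Cov ≤ Var. [difficulty: provable-now] [OsterwalderSeiler1978, Seiler1982,
FrohlichIsraelLiebSimon1978, BorgsSeiler1983, doi:10.1007/bf01614090, GlimmJaffe1987, Creutz2022]
#9 XiDiverges (support) — qualitative payoff ξ_lat(β) → ∞ uniformly over limit points (Chatterjee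
Problem 5.1, second half, without assuming existence of ξ): ∀ ε > 0 ∃ β₁ ∀ β ≥ β₁ ∀ μ ∃ m A, A > 0,
0 ≤ m ≤ ε, ∀ n, A e^(−mn) ≤ f_β(n e₀). Implied by XiExpLowerBound (proved in the planner's
Sketch.lean) and by either weaker rung via the glue items. [difficulty: open-problem]
[ChatterjeeYMProb2019, MontvayMunster1994]
#9 XiDivergesOfPolynomial (support) — glue: AxialLogConvexity → PolynomialWindow → XiDiverges (chord
inequality for the convex sequence log a(n), n ≥ 1, between 1 and t = ⌊β^p⌋: m ≤ (2 log N − log A +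
(2+8p) log β)/(t−1) → 0). [difficulty: provable-now] [Seiler1982, GlimmJaffe1987]
#9 XiDivergesOfFixedDistance (support) — glue: AxialLogConvexity → FixedDistanceLower →
PlaquetteVarianceUpper → XiDiverges (given ε pick n with (log B − log A + 8 log n)/(n−1) ≤ ε, then β
≥ max(β_n, β₁): m := (log a(1) − log a(n))/(n−1) ≤ ε since a(1) ≤ a(0) ≤ B/β² and a(n) ≥ A/(β²n⁸)).
[difficulty: provable-now] [Seiler1982, GlimmJaffe1987]
#9 AsymptoticFreedomBound (support) — summit-facing corollary in the Statement's own vocabulary: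
XiExpLowerBound → for every compact simple Lie G, every r, every `SpeciesScheme` sch and Δ > 0 with
`HasLatticeMassGap r sch Δ` and β_k → ∞, ∃ c > 0, K with Δ·a_k ≤ K β_k e^(−cβ_k) eventually — any
massive Wilson-lattice continuum limit must shrink its spacing at least exponentially in the bare
inverse coupling (a rigorous one-sided asymptotic-freedom inequality). Proof: HasLatticeMassGap is
uniform in the torus size S ≥ L_k, so a limit point μ_k along S ↦ 2S+1 (compactness, as
infiniteVolumeLimitPoints_nonempty_holds) has f(n e₀) ≤ C e^(−Δ a_k n) for all n (plaquette as a
`YMSpecies`, latticeConnectedCorr → plaquetteCorrFn), incompatible with A e^(−mn), A > 0, unless Δ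
a_k ≤ m ≤ K β_k e^(−cβ_k). [difficulty: M] [JaffeWitten2000, MontvayMunster1994,
ChatterjeeYMProb2019]

TWO-LAYER PLAN. Foreseen glued splits (k ≤ 3, depth 1), filed only after a crux closes:
ExponentialWindow ⇐ (SmallFieldGaussianWindow: on the event that
all plaquettes in a box of side 2n around the pair are O(β^(−1/2+δ))-close to 1, the conditional
covariance is ≥ (3/4)·LO) →
(LargeFieldRarity: that event has μ-probability ≥ 1 − n⁴e^(−cβ^(2δ)) uniformly over limit points, by
RP/chessboard or Balaban's
large-field bounds) → (BoundaryDecoupling: law of total covariance with the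
variance-of-conditional-expectation term ≥ 0 by the Markov
property in time and reflection symmetry) → ExponentialWindow; the same three children with n ≤ β^p
for PolynomialWindow;
FixedDistanceLower ⇐ (finite-volume β → ∞ Laplace asymptotics around flat connections incl. torons)
→ (volume-uniformity at fixed n via DLR +
chessboard) → FixedDistanceLower; PlaquetteVarianceUpper ⇐ (E(N−O_p) ≤ C/β from Chatterjee2016
convexity, tree ChatterjeeFreeEnergy*) →
(exponential tail of N−O_p above C'/β uniformly in the volume) → PlaquetteVarianceUpper.

KILL CRITERIA. No refutation of a window crux closes the line by itself unless it exhibits a compact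
simple G with f_β(n e₀) ≤ e^(−c' n) at n ≪ e^(cβ) for
arbitrarily large β (bounded ξ_lat along β → ∞) — that refutes XiDiverges, XiExpLowerBound and
Chatterjee's Problem 5.1 at once: close
`refuted:XiDiverges` and hand the witness to Literature.Barriers (it would make every Wilson-lattice
continuum limit ultralocal by
FixedCouplingUltralocality, i.e. ¬YangMills along Wilson schemes with β_k → ∞). ¬ExponentialWindow
with PolynomialWindow intact ⇒ pivot the
Target to the polynomial rate (restate XiExpLowerBound with m ≤ K log β/β^p).
¬PlaquetteVarianceUpper (Var ≫ 1/β²) would signal non-Gaussian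
local fluctuations at weak coupling and kills only the fixed-distance rung. AxialLogConvexity cannot
fail for β ≥ 0 (RP); if a refuter breaks
it, the tree's torus conventions are wrong, not the line. LatticeMassGapAllCouplings proved
elsewhere in full moots XiDiverges but not the rate.

NOT DECOMPOSED YET. The small-field/large-field split, the gauge fixing inside the perturbative box,
the lattice-Maxwell computation of the leading coefficient
c_G(n) n⁸ → (dim G)·κ_r²/(2π⁴) (positivity of the (0,1)|(0,1) orientation along e₀ checked by hand:
⟨F₀₁F₀₁⟩(n e₀) = −1/(π²n⁴) ≠ 0 in the
continuum), the existence of limit points along prescribed torus subsequences, and the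
plaquette-as-YMSpecies bookkeeping of
AsymptoticFreedomBound are layer-2 children or prover lemmas (`--supports`), not items. No slab sums
(they would need the clustering we do
not have); no use of the spectral theorem (log-convexity is proved by Cauchy–Schwarz directly).

CHEAPEST FALSIFIER. (i) Lookup: is ξ_lat(β) → ∞ for 4-d SU(2) (or any rigorous lower bound on a
weak-coupling plaquette covariance in infinite volume) already in
print? Searched (below): no. (ii) Sanity numerics (kit, cheap): SU(2) Monte-Carlo at β_phys =
2.4–2.7 on 16⁴: the axial plaquette–plaquette
connected correlator at n = 2…5 against the two-gluon formula c/(β²n⁸) (expect agreement within a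
factor 2 at n ≪ ξ) and log-convexity of the
measured a(n) (must hold exactly up to noise). (iii) The finite-group control: for G replaced by a
finite subgroup the window cruxes are FALSE
at large β (arXiv:2202.10375: exponential decay at weak coupling) — any proposed proof of a window
crux that does not use the Lie algebra is wrong.

NUMBERS. Tree normalisation: weight exp(β Σ_p Re tr r.ρ(U_p)), so for SU(N) fundamental β = β_phys/N
= 2/g². One loop: ξ_true ~ exp(β/(4b₀)) with
b₀ = 11N/(48π²) ⇒ any c < 12π²/(11N) is consistent; two-gluon exchange: a(n) ≈ (dim G) κ_r²
⟨F₀₁F₀₁⟩(ne₀)²/8 with ⟨F₀₁F₀₁⟩(ne₀) = −1/(π²n⁴)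
(continuum), i.e. a(n) ≈ (N²−1)/(2π⁴β²n⁸) for SU(N) fundamental. |O_p| ≤ N so a(n) ≤ N². Items: 12
(1 target, 5 cruxes, 1 assembly, 5 support) + the planner-proved deciding theorem `closes`.

DEFINITION REQUESTS. None: plaquetteCorrFn, infiniteVolumeLimitPoints, LatticeRep,
IsCompactSimpleLieGroup, SpeciesScheme, YMSpecies, HasLatticeMassGap all exist
(Literature.MathematicalPhysics.QuantumLattice.LatticeGaugeDLR,
Literature.MathematicalPhysics.QuantumFieldTheory.YangMillsOS). A plaquette
`YMSpecies` (single orientation) is built by the prover of AsymptoticFreedomBound like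
`LatticeRep.curvature`.

Novelty: Searches (2026-08-15): `lit frontier QuantumFields --since 2021` (30 rows: arXiv:2401.10507 YM–Higgs
scaling limit, arXiv:2606.19362 claimed RP
construction, nothing bounding ξ_lat from below); `lit bridges QuantumFields --cross any` (30 rows,
all CriticalPhenomena-side percolation/Ising);
`lit search --source crossref "leading term Yang-Mills free energy lattice gauge"` (7:
doi:10.1016/j.jfa.2016.04.032, doi:10.1007/s10955-026-03649-4
— bulk free energy only); `lit search --source crossref/arxiv "correlation decay finite lattice
gauge theories weak coupling"` (arXiv:2202.10375 =
doi:10.1214/24-aop1702: finite groups, decay not growth); `lit search --source crossref "transfer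
matrix positivity lattice gauge Luscher 1977"`
(doi:10.1007/bf01614090, doi:10.1103/physrevd.15.1128); `lit galaxy search "plaquette-plaquette
correlation" | "lower bound on the correlation
length" | "upper bound on the mass gap" | "correlation length diverges as" --star all` (10/3/0/16
rows: Rebbi (ed.), Montvay–Münster, spin-model
texts — no rigorous weak-coupling lower bound for non-abelian d = 4); local `lit search --hybrid` /
`lit vsearch` unavailable (searchd rc 75,
graph rerank reset) at filing; tree: `LatticeMassGapAllCouplings` registered OPEN incl. ξ → ∞;
card's own crossref searches and the refuter
novelty audit of the card (2026-08-15) found the same.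
Nearest prior art found: the RP half is folklore — positive transfer matrix and
spectral/log-convexity bounds "effective mass ≥ true mass"
(doi  [refs: 10.1016/j.jfa.2016.04.032, 10.1007/s10955-026-03649-4, 10.1214/24-aop1702:, 10.1007/bf01614090, 10.1103/physrevd.15.1128, 2401.10507, 2606.19362, 2202.10375, doi:10.1016/j.jfa.2016.04.032, doi:10.1007/s10955-026-03649-4, doi:10.1214/24-aop1702, doi:10.1007/bf01614090, doi:10.1103/physrevd.15.1128, Seiler1982, GlimmJaffe1987, Chatterjee2016, ChatterjeeYMProb2019]

Barriers (technique_class: rp-complete-monotonicity, perturbative-window): - technique_class: rp-complete-monotonicity, perturbative-window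
- Literature.Barriers.QuantumFields.PerturbativeInvisibility: respected — perturbation theory is
used only where the running coupling is small and only for a ONE-SIDED bound on ξ_lat; no mass is
read off a series, and the exponent c is necessarily below the true asymptotic-scaling rate (the
window must end before ξ), consistent with flatness of am(g).
- Literature.Barriers.QuantumFields.FixedCouplingUltralocality: not in its class — the line is the
barrier's constructive converse: it PROVES the lattice correlation length diverges along β → ∞,
which the barrier shows is necessary for any non-ultralocal `IsYangMillsFor` witness.
- Literature.Barriers.QuantumFields.AbelianDeconfinementD4: harmless — a LOWER bound on ξ_lat is
also true (and stronger) for U(1)₄, so group-blindness between abelian and non-abelian costs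
nothing; the statements are nevertheless quantified over compact simple Lie G only.
- Literature.Barriers.QuantumFields.ZnHiggsPhaseD4: evaded by the binder and by the mechanism — for
finite gauge groups the window cruxes are false (action gap, freezing; arXiv:2202.10375), and the
perturbative window uses the Lie algebra (Gaussian fluctuations of size β^(−1/2)), so no
discreteness-blind argument is attempted.
- Literature.Barriers.QuantumFields.UVStabilityNonUniqueness: not in the class — no continuum limit
and no subsequence extraction of a theory is taken; only finite-β lattice expectations are bounde

sub-problem: YangMills · status: draft · opened planner-plancard-QuantumFields-YangMills-xi-l-d510cfdb-0 2026-08-15T13:43:44Z · rev 1 · ledger route-QuantumFields-XiCompleteMonotonicity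
GENERATED by the gate from the ledger (D-0016/17). Provers cite these decls: `theorem foo : Summit.QuantumFields.YangMills.Theses.XiCompleteMonotonicity.<Decl> := …` in Summits/QuantumFields/YangMills/Theorems/<Name>.lean.
-/

namespace Summit.QuantumFields.YangMills.Theses.XiCompleteMonotonicity

open scoped BigOperators Topology Manifold Classical MeasureTheory ProbabilityTheory Matrix InnerProductSpace ComplexConjugate ContinuousMap
open Filter Set Function TopologicalSpace MeasureTheory

/-- item stmt-QuantumFields-8935 · target · rank 0 · open · by planner
why it might fail: Only through ExponentialWindow: certified lattice PT out to e^(cβ) separations uniformly over ALL torus limit points is an unbuilt Balaban-with-observables theorem; the RP half cannot fail for β ≥ 0.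
sources: ChatterjeeYMProb2019, Chatterjee2016, Balaban1989LargeFieldII, Seiler1982
[target] X as in § Thesis: for every compact simple Lie G and faithful unitary r, ∃ β₀ c K, c > 0, ∀
β ≥ β₀, ∀ μ ∈ infiniteVolumeLimitPoints r.ρ β, ∃ m A, A > 0, 0 ≤ m ≤ K β e^(−cβ), ∀ n, A e^(−mn) ≤
f_β(n e₀) (card item X, quantified over limit points as in Chatterjee Problem 5.1). -/
def XiExpLowerBound : Prop :=
  ∀ (G : Type) [Group G] [TopologicalSpace G] [IsTopologicalGroup G] [CompactSpace G] [MeasurableSpace G] [BorelSpace G], Literature.MathematicalPhysics.QuantumFieldTheory.IsCompactSimpleLieGroup G → ∀ r : Literature.MathematicalPhysics.QuantumFieldTheory.LatticeRep G, ∃ β₀ c K : ℝ, 0 < c ∧ ∀ β : ℝ, β₀ ≤ β → ∀ μ ∈ Literature.MathematicalPhysics.QuantumLattice.infiniteVolumeLimitPoints (d := 4) r.ρ β, ∃ m A : ℝ, 0 < A ∧ 0 ≤ m ∧ m ≤ K * β * Real.exp (-(c * β)) ∧ ∀ n : ℕ, A * Real.exp (-(m * n)) ≤ Literature.MathematicalPhysics.QuantumLattice.plaquetteCorrFn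 r.ρ μ ((n : ℤ) • Pi.single (0 : Fin 4) (1 : ℤ))

/-- item stmt-QuantumFields-8936 · crux · rank 2 · open · by planner
why it might fail: Needs PT with running coupling certified over ~cβ RG scales, uniformly in the volume and over limit points (Balaban with observables, never built); Balaban's large-field remainders are absolute while a ~ β⁻²n⁻⁸ is tiny, so relative accuracy may exceed the method.
sources: Balaban1987RG1, Balaban1988Convergent, Balaban1989LargeFieldII, JaffeWitten2000, Chatterjee2016, Dimock2022QED3
[crux] exponential perturbative window (card K2): ∃ β₀, c > 0, A > 0, n₀ such that for all β ≥ β₀,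
every limit point μ at β and all n₀ ≤ n ≤ e^(cβ): f_β(n e₀) ≥ A/(β² n⁸) — leading-order (two-gluon)
lattice perturbation theory for the axial plaquette two-point function is accurate to a factor out
to exponentially large separations, where the running coupling is still small. [difficulty:
open-problem] -/
def ExponentialWindow : Prop :=
  ∀ (G : Type) [Group G] [TopologicalSpace G] [IsTopologicalGroup G] [CompactSpace G] [MeasurableSpace G] [BorelSpace G], Literature.MathematicalPhysics.QuantumFieldTheory.IsCompactSimpleLieGroup G → ∀ r : Literature.MathematicalPhysics.QuantumFieldTheory.LatticeRep G, ∃ β₀ c A : ℝ, ∃ n₀ : ℕ, 0 < c ∧ 0 < A ∧ ∀ β : ℝ, β₀ ≤ β → ∀ μ ∈ Literature.MathematicalPhysics.QuantumLattice.infiniteVolumeLimitPoints (d := 4) r.ρ β, ∀ n : ℕ, n₀ ≤ n → (n : ℝ) ≤ Real.exp (c * β) → A / (β ^ 2 * (n : ℝ) ^ 8) ≤ Literature.MathematicalPhysics.QuantumLattice.plaquetteCorrFn r.ρ μ ((n : ℤ) • Pi.single (0 : Fin 4) (1 : ℤ))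

/-- item stmt-QuantumFields-8937 · crux · rank 3 · open · by planner
why it might fail: Still a multi-scale expansion in infinite volume at fixed large β where the IR is non-perturbative: no cluster expansion converges uniformly in the volume there, and the random boundary data outside the perturbative box must be shown to affect a(n) only at relative order <1.
sources: Balaban1987RG1, Balaban1988Convergent, Chatterjee2016, doi:10.1007/s10955-026-03649-4, arXiv:2202.10375
[crux] polynomial perturbative window (the card's "file first" rung): ∃ β₀, p > 0, A > 0, n₀ with
f_β(n e₀) ≥ A/(β² n⁸) for all β ≥ β₀, all limit points μ and all n₀ ≤ n ≤ β^p. Only O(log β) scales,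
over which the coupling does not run appreciably (no coupling-constant renormalisation); with
AxialLogConvexity it already gives ξ_lat ≥ β^p/((8p+2) log β + C) → ∞ (glue XiDivergesOfPolynomial).
[difficulty: XL] -/
def PolynomialWindow : Prop :=
  ∀ (G : Type) [Group G] [TopologicalSpace G] [IsTopologicalGroup G] [CompactSpace G] [MeasurableSpace G] [BorelSpace G], Literature.MathematicalPhysics.QuantumFieldTheory.IsCompactSimpleLieGroup G → ∀ r : Literature.MathematicalPhysics.QuantumFieldTheory.LatticeRep G, ∃ β₀ p A : ℝ, ∃ n₀ : ℕ, 0 < p ∧ 0 < A ∧ ∀ β : ℝ, β₀ ≤ β → ∀ μ ∈ Literature.MathematicalPhysics.QuantumLattice.infiniteVolumeLimitPoints (d := 4) r.ρ β, ∀ n : ℕ, n₀ ≤ n → (n : ℝ) ≤ β ^ p → A / (β ^ 2 * (n : ℝ) ^ 8) ≤ Literature.MathematicalPhysics.QuantumLattice.plaquetteCorrFn r.ρ μ ((n : ℤ) • Pi.single (0 : Fin 4) (1 : ℤ))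

/-- item stmt-QuantumFields-8938 · crux · rank 4 · open · by planner
why it might fail: Even E(N−O_p) ≍ 1/β in infinite volume is known only via free-energy convexity (Chatterjee2016); a covariance at distance n needs genuinely local control of large fields and of the non-perturbative boundary, uniformly over limit points (odd tori: no chessboard).
sources: Chatterjee2016, doi:10.1007/s10955-026-03649-4, FrohlichLieb1978, FrohlichIsraelLiebSimon1978, Chatterjee2026YMHiggs
[crux] fixed-distance leading-order lower asymptotics, pointwise in the separation: ∃ A > 0, n₀ such
that for every n ≥ n₀ there is β_n with f_β(n e₀) ≥ A/(β² n⁸) for all β ≥ β_n and all limit points μ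
at β — local weak-coupling Gaussianity of 4-d non-abelian lattice gauge theory at the level of one
covariance, uniformly over infinite-volume limit points (finitely many scales; chessboard/RP
large-field bounds + Markov property + integration by parts are the non-Balaban tools). With
PlaquetteVarianceUpper and AxialLogConvexity it gives XiDiverges (glue XiDivergesOfFixedDistance).
[difficulty: L] -/
def FixedDistanceLower : Prop :=
  ∀ (G : Type) [Group G] [TopologicalSpace G] [IsTopologicalGroup G] [CompactSpace G] [MeasurableSpace G] [BorelSpace G], Literature.MathematicalPhysics.QuantumFieldTheory.IsCompactSimpleLieGroup G → ∀ r : Literature.MathematicalPhysics.QuantumFieldTheory.LatticeRep G, ∃ A : ℝ, ∃ n₀ : ℕ, 0 < A ∧ ∀ n : ℕ, n₀ ≤ n → ∃ β₁ : ℝ, ∀ β : ℝ, β₁ ≤ β → ∀ μ ∈ Literature.MathematicalPhysics.QuantumLattice.infiniteVolumeLimitPoints (d := 4) r.ρ β, A / (β ^ 2 * (n : ℝ) ^ 8) ≤ Literature.MathematicalPhysics.QuantumLattice.plaquetteCorrFn r.ρ μ ((n : ℤ) • Pi.single (0 : Fin 4) (1 : ℤ))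

/-- item stmt-QuantumFields-8939 · crux · rank 5 · open · by planner
why it might fail: Convexity of the free energy yields only E(N−O_p)=O(1/β), hence Var=O(1/β), one log β short in the glue; the sharp O(1/β²) needs a fourth-moment / large-field bound uniform over ALL torus limit points (odd tori lack chessboard estimates).
sources: Chatterjee2016, doi:10.1007/s10955-026-03649-4, FrohlichLieb1978, MontvayMunster1994
[crux] sharp second moment: ∃ B, β₁ with Var_μ(Re tr r.ρ(U_p)) = f_β(0) ≤ B/β² for all β ≥ β₁ and
all limit points μ at β (one-loop: Var ≈ dim G · O(g⁴)); the normaliser that turns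
FixedDistanceLower into ξ_lat → ∞, and the first genuinely local weak-coupling estimate in infinite
volume. [difficulty: M] -/
def PlaquetteVarianceUpper : Prop :=
  ∀ (G : Type) [Group G] [TopologicalSpace G] [IsTopologicalGroup G] [CompactSpace G] [MeasurableSpace G] [BorelSpace G], Literature.MathematicalPhysics.QuantumFieldTheory.IsCompactSimpleLieGroup G → ∀ r : Literature.MathematicalPhysics.QuantumFieldTheory.LatticeRep G, ∃ B β₁ : ℝ, ∀ β : ℝ, β₁ ≤ β → ∀ μ ∈ Literature.MathematicalPhysics.QuantumLattice.infiniteVolumeLimitPoints (d := 4) r.ρ β, Literature.MathematicalPhysics.QuantumLattice.plaquetteCorrFn r.ρ μ 0 ≤ B / β ^ 2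

/-- item stmt-QuantumFields-9640 · crux · rank 6 · open · by planner
why it might fail: It is the rest of the Millennium problem: X gives only a_k → 0 and a one-sided rate; the gap leg (upper bound on ξ_lat at a matched rate, all observables, uniform in volume) and the UV/OS legs (convergence, not just UV stability) are open.
sources: JaffeWitten2000, Balaban1988Convergent, MagnenRivasseauSeneor1993, OsterwalderSeiler1978, GlimmJaffe1987
[crux] the remainder of the Clay problem GIVEN X, shared with every lattice-first line (gap leg +
UV/OS legs): for every compact simple Lie G and faithful unitary r, X's conclusion for (G, r) → ∃ a
sequential scheme sch and OS data T with IsYangMillsFor r sch T, non-trivial and non-Gaussian tr F²,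
and Δ > 0 with T.HasMassGap Δ ∧ HasLatticeMassGap r sch Δ. X enters exactly once: the scale-setting
a_k := m(β_k)/Δ_phys has a_k → 0 (and a_k ≤ K β_k e^(−cβ_k)/Δ) because m(β_k) ≤ K β_k e^(−cβ_k);
everything else (volume-uniform lattice gap at the matched rate, joint continuum limit of all
gauge-invariant Schwinger functions, E0–E4, non-Gaussianity) is owned by the gap/UV cards
(ricci-heat-kernel-polchinski-lsi-gap, parabolic-renormalised-trajectory,
finite-size-criterion-crossover, os-legs-fine-print) and sibling routes' `…ToClay` items. Filed so
that the deciding theorem `closes : XiExpLowerBound → XiRemainderToClay → YangMills` (pure logic,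
planner's Closes.lean) exists (D-0027 §2.1). [deps: XiExpLowerBound] [difficulty: open-problem] -/
def XiRemainderToClay : Prop :=
  ∀ (G : Type) [Group G] [TopologicalSpace G] [IsTopologicalGroup G] [CompactSpace G] [MeasurableSpace G] [BorelSpace G], Literature.MathematicalPhysics.QuantumFieldTheory.IsCompactSimpleLieGroup G → ∀ r : Literature.MathematicalPhysics.QuantumFieldTheory.LatticeRep G, (∃ β₀ c K : ℝ, 0 < c ∧ ∀ β : ℝ, β₀ ≤ β → ∀ μ ∈ Literature.MathematicalPhysics.QuantumLattice.infiniteVolumeLimitPoints (d := 4) r.ρ β, ∃ m A : ℝ, 0 < A ∧ 0 ≤ m ∧ m ≤ K * β * Real.exp (-(c * β)) ∧ ∀ n : ℕ, A * Real.exp (-(m * n)) ≤ Literature.MathematicalPhysics.QuantumLattice.plaquetteCorrFn r.ρ μ ((n : ℤ) • Pi.single (0 : Fin 4) (1 : ℤ))) → ∃ (sch : Literature.MathematicalPhysics.QuantumFieldTheory.SpeciesScheme (Literature.MathematicalPhysics.QuantumFieldTheory.YMSpecies G)) (T : Literature.MathematicalPhysics.QuantumFieldTheory.OSData (Literature.MathematicalPhysics.QuantumFieldTheory.YMSpecies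 G) 4), Literature.MathematicalPhysics.QuantumFieldTheory.IsYangMillsFor r sch T ∧ T.IsNontrivial r.curvature ∧ T.IsNonGaussian r.curvature ∧ ∃ Δ > 0, T.HasMassGap Δ ∧ Literature.MathematicalPhysics.QuantumFieldTheory.HasLatticeMassGap r sch Δ

/-- item stmt-QuantumFields-8940 · support · rank 9 · open · by planner
sources: OsterwalderSeiler1978, Seiler1982, FrohlichIsraelLiebSimon1978, BorgsSeiler1983, doi:10.1007/bf01614090, GlimmJaffe1987
[support] the RP half (provable now): for β ≥ 0 and every limit point μ, a(n) = f_β(n e₀) satisfies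
0 ≤ a(n), a(n+1) ≤ a(n), a(n) ≤ N², and a(n+2)² ≤ a(n+1)·a(n+3) for all n — non-negativity and
log-convexity from the Cauchy–Schwarz inequality of the site-plane (odd separations) and half-plane
(even separations ≥ 2) reflection-positive forms applied to centred plaquettes, exactly as tree
TorusSiteRP/TorusLoopLinkRP/TorusOddRP do for Wilson loops, then passage to limit points as in
StringTension.hasStringTension_of_eventually; monotonicity from boundedness + log-convexity and Cov
≤ Var. [difficulty: provable-now] -/
def AxialLogConvexity : Prop :=
  ∀ (G : Type) [Group G] [TopologicalSpace G] [IsTopologicalGroup G] [CompactSpace G] [MeasurableSpace G] [BorelSpace G], Literature.MathematicalPhysics.QuantumFieldTheory.IsCompactSimpleLieGroup G → ∀ r : Literature.MathematicalPhysics.QuantumFieldTheory.LatticeRep G, ∀ β : ℝ, 0 ≤ β → ∀ μ ∈ Literature.MathematicalPhysics.QuantumLattice.infiniteVolumeLimitPoints (d := 4) r.ρ β, ∀ n : ℕ, 0 ≤ Literature.MathematicalPhysics.QuantumLattice.plaquetteCorrFn r.ρ μ ((n : ℤ) • Pi.single (0 : Fin 4) (1 : ℤ)) ∧ Literature.MathematicalPhysics.QuantumLattice.plaquetteCorrFn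 r.ρ μ (((n + 1 : ℕ) : ℤ) • Pi.single (0 : Fin 4) (1 : ℤ)) ≤ Literature.MathematicalPhysics.QuantumLattice.plaquetteCorrFn r.ρ μ ((n : ℤ) • Pi.single (0 : Fin 4) (1 : ℤ)) ∧ Literature.MathematicalPhysics.QuantumLattice.plaquetteCorrFn r.ρ μ ((n : ℤ) • Pi.single (0 : Fin 4) (1 : ℤ)) ≤ (r.N : ℝ) ^ 2 ∧ Literature.MathematicalPhysics.QuantumLattice.plaquetteCorrFn r.ρ μ (((n + 2 : ℕ) : ℤ) • Pi.single (0 : Fin 4) (1 : ℤ)) ^ 2 ≤ Literature.MathematicalPhysics.QuantumLattice.plaquetteCorrFn r.ρ μ (((n + 1 : ℕ) : ℤ) • Pi.single (0 : Fin 4) (1 : ℤ)) * Literature.MathematicalPhysics.QuantumLattice.plaquetteCorrFn r.ρ μ (((n + 3 : ℕ) : ℤ) • Pi.single (0 : Fin 4) (1 : ℤ))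

/-- item stmt-QuantumFields-8941 · support · rank 9 · open · by planner
sources: ChatterjeeYMProb2019, MontvayMunster1994
[support] qualitative payoff ξ_lat(β) → ∞ uniformly over limit points (Chatterjee Problem 5.1,
second half, without assuming existence of ξ): ∀ ε > 0 ∃ β₁ ∀ β ≥ β₁ ∀ μ ∃ m A, A > 0, 0 ≤ m ≤ ε, ∀
n, A e^(−mn) ≤ f_β(n e₀). Implied by XiExpLowerBound (proved in the planner's Sketch.lean) and by
either weaker rung via the glue items. [difficulty: open-problem] -/
def XiDiverges : Prop :=
  ∀ (G : Type) [Group G] [TopologicalSpace G] [IsTopologicalGroup G] [CompactSpace G] [MeasurableSpace G] [BorelSpace G], Literature.MathematicalPhysics.QuantumFieldTheory.IsCompactSimpleLieGroup G → ∀ r : Literature.MathematicalPhysics.QuantumFieldTheory.LatticeRep G, ∀ ε : ℝ, 0 < ε → ∃ β₁ : ℝ, ∀ β : ℝ, β₁ ≤ β → ∀ μ ∈ Literature.MathematicalPhysics.QuantumLattice.infiniteVolumeLimitPoints (d := 4) r.ρ β, ∃ m A : ℝ, 0 < A ∧ 0 ≤ m ∧ m ≤ ε ∧ ∀ n : ℕ,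 A * Real.exp (-(m * n)) ≤ Literature.MathematicalPhysics.QuantumLattice.plaquetteCorrFn r.ρ μ ((n : ℤ) • Pi.single (0 : Fin 4) (1 : ℤ))

/-- item stmt-QuantumFields-8942 · support · rank 9 · open · by planner
sources: Seiler1982, GlimmJaffe1987
[support] glue: AxialLogConvexity → PolynomialWindow → XiDiverges (chord inequality for the convex
sequence log a(n), n ≥ 1, between 1 and t = ⌊β^p⌋: m ≤ (2 log N − log A + (2+8p) log β)/(t−1) → 0).
[difficulty: provable-now] -/
def XiDivergesOfPolynomial : Prop :=
  AxialLogConvexity → PolynomialWindow → XiDiverges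

/-- item stmt-QuantumFields-8943 · support · rank 9 · open · by planner
sources: Seiler1982, GlimmJaffe1987
[support] glue: AxialLogConvexity → FixedDistanceLower → PlaquetteVarianceUpper → XiDiverges (given
ε pick n with (log B − log A + 8 log n)/(n−1) ≤ ε, then β ≥ max(β_n, β₁): m := (log a(1) − log
a(n))/(n−1) ≤ ε since a(1) ≤ a(0) ≤ B/β² and a(n) ≥ A/(β²n⁸)). [difficulty: provable-now] -/
def XiDivergesOfFixedDistance : Prop :=
  AxialLogConvexity → FixedDistanceLower → PlaquetteVarianceUpper → XiDiverges

/-- item stmt-QuantumFields-8944 · support · rank 9 · open · by planner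
sources: JaffeWitten2000, MontvayMunster1994, ChatterjeeYMProb2019
[support] summit-facing corollary in the Statement's own vocabulary: XiExpLowerBound → for every
compact simple Lie G, every r, every `SpeciesScheme` sch and Δ > 0 with `HasLatticeMassGap r sch Δ`
and β_k → ∞, ∃ c > 0, K with Δ·a_k ≤ K β_k e^(−cβ_k) eventually — any massive Wilson-lattice
continuum limit must shrink its spacing at least exponentially in the bare inverse coupling (a
rigorous one-sided asymptotic-freedom inequality). Proof: HasLatticeMassGap is uniform in the torus
size S ≥ L_k, so a limit point μ_k along S ↦ 2S+1 (compactness, as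
infiniteVolumeLimitPoints_nonempty_holds) has f(n e₀) ≤ C e^(−Δ a_k n) for all n (plaquette as a
`YMSpecies`, latticeConnectedCorr → plaquetteCorrFn), incompatible with A e^(−mn), A > 0, unless Δ
a_k ≤ m ≤ K β_k e^(−cβ_k). [difficulty: M] -/
def AsymptoticFreedomBound : Prop :=
  XiExpLowerBound → ∀ (G : Type) [Group G] [TopologicalSpace G] [IsTopologicalGroup G] [CompactSpace G] [MeasurableSpace G] [BorelSpace G], Literature.MathematicalPhysics.QuantumFieldTheory.IsCompactSimpleLieGroup G → ∀ (r : Literature.MathematicalPhysics.QuantumFieldTheory.LatticeRep G) (sch : Literature.MathematicalPhysics.QuantumFieldTheory.SpeciesScheme (Literature.MathematicalPhysics.QuantumFieldTheory.YMSpecies G)) (Δ : ℝ), 0 < Δ → Literature.MathematicalPhysics.QuantumFieldTheory.HasLatticeMassGap r sch Δ → Filter.Tendsto sch.β Filter.atTop Filter.atTop → ∃ c K : ℝ, 0 < c ∧ ∀ᶠ k in Filter.atTop, Δ * sch.a k ≤ K * sch.β k * Real.exp (-(c * sch.β k))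

/-- item stmt-QuantumFields-8945 · assembly · rank 1 · open · by planner
sources: Seiler1982, GlimmJaffe1987, ChatterjeeYMProb2019
[assembly] AxialLogConvexity → ExponentialWindow → XiExpLowerBound. -/
def Assembly : Prop :=
  AxialLogConvexity → ExponentialWindow → XiExpLowerBound

/-! D-0027 §2.1 — DECIDING THEOREM (planner-authored via `route open/edit --closes-file`; by planner-plancard-QuantumFields-YangMills-xi-l-d510cfdb-0 2026-08-15T14:06:18Z):
its hypotheses are this route's items and its conclusion the sub-problem Statement (glue_lint), and it elaborates with this file. -/

/-- ROUTE GLUE (D-0019 / D-0027 §2.1), PURE LOGIC: the Target `XiExpLowerBound` (itself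
`AxialLogConvexity → ExponentialWindow → XiExpLowerBound`, the Assembly item) supplies, for the
faithful representation `r` that `IsCompactSimpleLieGroup G` provides, the hypothesis of the
remainder item `XiRemainderToClay`, which returns the witness clause of `YangMills`. -/
theorem closes : XiExpLowerBound → XiRemainderToClay → YangMills := by
  intro hX hR G _ _ _ _ hG
  letI : MeasurableSpace G := borel G
  haveI : BorelSpace G := ⟨rfl⟩
  obtain ⟨r⟩ := hG.2
  exact ⟨r, hR G hG r (hX G hG r)⟩

end Summit.QuantumFields.YangMills.Theses.XiCompleteMonotonicity
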